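import Summits.KontsevichZagierPeriods.KontsevichZagierPeriods.Theses.Grothendieck
import Literature.Analysis.SpecialFunctions.LemniscaticEllipticValuesProofs
import Literature.NumberTheory.Transcendental.KontsevichZagierGammaProofs
import Literature.Barriers.Schanuel.NesterenkoModularScopeConjectureProofs

/-!
# KontsevichZagierPeriods / Grothendieck — `KEAlgIndependent` (stmt-KontsevichZagierPeriods-8611)

Route `KontsevichZagierPeriods/Grothendieck`, support item stmt-KontsevichZagierPeriods-8611:

  `AlgebraicIndependent ℚ ![K, E]`, `K = ∫_{(0,1)} dx/√((1 − x²)(1 − x²/2)) = K(1/√2)`,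
  `E = ∫_{(0,1)} √(1 − x²/2)/√(1 − x²) dx = E(1/√2)`

(the complete elliptic integrals at the lemniscatic modulus `k² = 1/2` are algebraically
independent over `ℚ`). All inputs are PROVED tree theorems; the result is unconditional.

## Proof

The two integrals are verbatim `Literature.Analysis.SpecialFunctions.lemniscaticK` /
`lemniscaticE`. Put `F := ℚ(K, E) ⊆ ℝ`.

* Legendre's relation at `k = 1/√2`, `2EK − K² = π/2`
  (`Literature.Analysis.SpecialFunctions.Lawden1989_eq_3_8_29_lemniscatic_holds`), gives
  `π = 4EK − 2K² ∈ F`.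
* Lawden (4.3.6), `K = Γ(1/4)²/(4√π)`
  (`Literature.Analysis.SpecialFunctions.Lawden1989_eq_4_3_6_holds`), gives `Γ(1/4)⁴ = 16πK² ∈ F`,
  so `Γ(1/4)` is algebraic over `F` (`IsAlgebraic.of_pow`).
* Hence `F(π, Γ(1/4))` is algebraic over `F` and `trdeg_ℚ F(π, Γ(1/4)) = trdeg_ℚ F` (tower law
  `trdeg_add_eq`, `trdeg_eq_zero`: tree lemma
  `Literature.Barriers.Schanuel.trdeg_adjoin_union_eq_of_isAlgebraic_adjoin`, imported from
  `NesterenkoModularScopeConjectureProofs.lean`, where this folklore helper currently lives).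
* Chudnovsky (1976): `π`, `Γ(1/4)` are algebraically independent over `ℚ`
  (`Literature.NumberTheory.Transcendental.algebraicIndependent_real_pi_gamma_one_quarter`), so
  `2 ≤ trdeg_ℚ F(π, Γ(1/4))` (`AlgebraicIndependent.cardinalMk_le_trdeg` applied to the pair
  corestricted to the subfield).
* `2 ≤ trdeg_ℚ ℚ(K, E)` forces `![K, E]` algebraically independent
  (`Literature.Barriers.Schanuel.algebraicIndependent_of_le_trdeg_adjoin`).

References: G. V. Chudnovsky, *Contributions to the theory of transcendental numbers* (1984),
Ch. 7 §2 Cor. 2.3; D. F. Lawden, *Elliptic Functions and Applications* (1989), (3.8.29), (4.3.6),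
Ch. 3 Ex. 24–25; M. Waldschmidt, *Elliptic functions and transcendence* (2008), §5.2 Cor. 33.
-/

noncomputable section

open IntermediateField

namespace Summit.KontsevichZagierPeriods.Grothendieck

open Literature.Analysis.SpecialFunctions Literature.NumberTheory.Transcendental

/-- If an algebraically independent family `y : Fin m → L` over `K` takes values in the subfield
`K(S)`, then `m ≤ trdeg_K K(S)` (`AlgebraicIndependent.cardinalMk_le_trdeg` for the corestricted
family, which is algebraically independent by `AlgebraicIndependent.of_comp` along the inclusion
`K(S) → L`). [folklore] -/
theorem le_trdeg_adjoin_of_algebraicIndependent {K L : Type*} [Field K] [Field L] [Algebra K L]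
    {m : ℕ} (S : Set L) (y : Fin m → L) (hy : AlgebraicIndependent K y)
    (hyS : ∀ i, y i ∈ adjoin K S) : (m : Cardinal) ≤ Algebra.trdeg K (adjoin K S) := by
  let y' : Fin m → adjoin K S := fun i => ⟨y i, hyS i⟩
  have hcomp : ((adjoin K S).val : adjoin K S → L) ∘ y' = y := by
    funext i
    rfl
  have hy' : AlgebraicIndependent K y' := by
    refine AlgebraicIndependent.of_comp (adjoin K S).val ?_
    rw [hcomp]
    exact hy
  simpa using hy'.lift_cardinalMk_le_trdeg

/-- **`K(1/√2)` and `E(1/√2)` are algebraically independent over `ℚ`** (settles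
stmt-KontsevichZagierPeriods-8611, route Grothendieck, decl `KEAlgIndependent`):
`AlgebraicIndependent ℚ ![∫_{(0,1)} dx/√((1−x²)(1−x²/2)), ∫_{(0,1)} √(1−x²/2)/√(1−x²) dx]`.
Proof: with `F = ℚ(K, E)`, Legendre's relation `2EK − K² = π/2` (Lawden (3.8.29) at `k = 1/√2`,
tree theorem) puts `π ∈ F`, Lawden (4.3.6) `K = Γ(1/4)²/(4√π)` (tree theorem) puts
`Γ(1/4)⁴ = 16πK² ∈ F`; so `trdeg_ℚ F = trdeg_ℚ F(π, Γ(1/4)) ≥ 2` by Chudnovsky's theorem (`π`,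
`Γ(1/4)` algebraically independent, tree theorem
`algebraicIndependent_real_pi_gamma_one_quarter`), and a pair generating a field of transcendence
degree `≥ 2` is algebraically independent.
[cite: Chudnovsky1984, Ch. 7 §2 Corollary 2.3] [cite: Lawden1989, §3.8 (3.8.29), §4.3 (4.3.6)] -/
theorem keAlgIndependent_proof :
    Summit.KontsevichZagierPeriods.KontsevichZagierPeriods.Theses.Grothendieck.KEAlgIndependent := by
  unfold Summit.KontsevichZagierPeriods.KontsevichZagierPeriods.Theses.Grothendieck.KEAlgIndependent
  -- the two integrals are verbatim `lemniscaticK`, `lemniscaticE`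
  show AlgebraicIndependent ℚ ![lemniscaticK, lemniscaticE]
  have hK : lemniscaticK = Real.Gamma (1 / 4) ^ 2 / (4 * Real.sqrt Real.pi) :=
    Lawden1989_eq_4_3_6_holds
  have hL : 2 * lemniscaticE * lemniscaticK - lemniscaticK ^ 2 = Real.pi / 2 :=
    Lawden1989_eq_3_8_29_lemniscatic_holds
  set l : Fin 2 → ℝ := ![lemniscaticK, lemniscaticE]
  set S : Set ℝ := Set.range l
  set F : IntermediateField ℚ ℝ := adjoin ℚ S
  have hKF : lemniscaticK ∈ F := subset_adjoin ℚ S ⟨0, rfl⟩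
  have hEF : lemniscaticE ∈ F := subset_adjoin ℚ S ⟨1, rfl⟩
  -- `π = 4EK − 2K² ∈ F`
  have hpi_eq : Real.pi = 4 * lemniscaticE * lemniscaticK - 2 * lemniscaticK ^ 2 := by
    linarith
  have hpiF : Real.pi ∈ F := by
    rw [hpi_eq]
    exact sub_mem (mul_mem (mul_mem (by exact_mod_cast F.natCast_mem 4) hEF) hKF)
      (mul_mem (by exact_mod_cast F.natCast_mem 2) (pow_mem hKF 2))
  -- `Γ(1/4)⁴ = 16 π K² ∈ F`
  have hsqrt : Real.sqrt Real.pi ^ 2 = Real.pi := Real.sq_sqrt Real.pi_pos.le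
  have hG4 : Real.Gamma (1 / 4) ^ 4 = 16 * Real.pi * lemniscaticK ^ 2 := by
    rw [hK, div_pow, mul_pow, hsqrt]
    field_simp
    ring
  have hG4F : Real.Gamma (1 / 4) ^ 4 ∈ F := by
    rw [hG4]
    exact mul_mem (mul_mem (by exact_mod_cast F.natCast_mem 16) hpiF) (pow_mem hKF 2)
  -- `T = {π, Γ(1/4)}` is algebraic over `F`
  set T : Set ℝ := {Real.pi, Real.Gamma (1 / 4)}
  have hTalg : ∀ x ∈ T, IsAlgebraic F x := by
    intro x hx
    rcases hx with rfl | rfl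
    · exact isAlgebraic_algebraMap (⟨Real.pi, hpiF⟩ : F)
    · have h4 : IsAlgebraic F (Real.Gamma (1 / 4) ^ 4) :=
        isAlgebraic_algebraMap (⟨Real.Gamma (1 / 4) ^ 4, hG4F⟩ : F)
      exact h4.of_pow (by norm_num)
  -- Chudnovsky: `2 ≤ trdeg_ℚ ℚ(S ∪ T)`
  have hy : AlgebraicIndependent ℚ ![Real.pi, Real.Gamma (1 / 4)] :=
    algebraicIndependent_real_pi_gamma_one_quarter
  have hyST : ∀ i, (![Real.pi, Real.Gamma (1 / 4)] : Fin 2 → ℝ) i ∈ adjoin ℚ (S ∪ T) := by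
    intro i
    refine subset_adjoin ℚ (S ∪ T) (Or.inr ?_)
    fin_cases i
    · exact Or.inl rfl
    · exact Or.inr rfl
  have h2 := le_trdeg_adjoin_of_algebraicIndependent (S ∪ T) _ hy hyST
  -- transfer to `F = ℚ(S)` and conclude
  rw [Literature.Barriers.Schanuel.trdeg_adjoin_union_eq_of_isAlgebraic_adjoin S T hTalg] at h2
  exact Literature.Barriers.Schanuel.algebraicIndependent_of_le_trdeg_adjoin l h2

end Summit.KontsevichZagierPeriods.Grothendieck

end
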